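import Summits.CriticalPhenomena.SAWScalingLimit.Theorems.SAWReversalUpgradeAttachReversalDefs
import Literature.Probability.Percolation.LoopRotationInvarianceAssembly
import Literature.Probability.LatticeModels.MeshLoops

/-!
# Attachment reversal: the dyadic polyline of a lattice walk and of its reversal

Helper file for item `AttachReversal` of route `SAWReversalUpgrade` (stmt-CriticalPhenomena-18007).
The route's polyline `P = γ.walk.toCurve (meshPoint δ)` is the tree's dyadic `polyline`, i.e.
`affineInterp L ∘ dyadicTime n` (`polyline_cons_apply`) with `L` the list of mesh points of the walk
and `n` its length; the polyline of the REVERSED walk is `affineInterp L (n - dyadicTime n ·)`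
(`affineInterp_reverse`). Hence, writing `U s = affineInterp L (n · clamp s)` and
`h u = dyadicTime n (clamp u) / n`:

* `projLine_toCurve_eq`, `projLine_toCurve_reverse_eq` — `R = U ∘ h` and `R' = (U ∘ (1 - ·)) ∘ h`
  for the extended polylines `R`, `R'` of the walk and of its reversal (length `n ≥ 1`);
* `continuous_timeChange`, `monotone_timeChange`, `timeChange_zero/one`, `timeChange_plateau` —
  `h` is a continuous monotone time change of `[0, 1]`, injective off its top plateau
  (`dyadicTime_eq_of_eq`);
* `affineInterp_support_mem_closure` — `U` takes values in `closure Ω` as soon as the starting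
  mesh point does (edges of the mesh graph are segments of `closure Ω`);
* `affineInterp_support_length`, endpoint bookkeeping (injectivity of `meshPoint` is the tree's
  `Mesh.meshPoint_injective`).
-/

noncomputable section

open Set Function
open Literature.Probability.RandomPlanarGeometry Literature.Probability.LatticeModels
  Literature.Probability.Percolation

namespace Summit.CriticalPhenomena.SAWScalingLimit.Theorems.AttachReversal

/-! ### The dyadic time change -/

/-- `dyadicTime n t ≤ n` for `t ≤ 1`. -/
theorem dyadicTime_le {n : ℕ} {t : ℝ} (ht : t ≤ 1) : dyadicTime n t ≤ n := by
  have := monotone_dyadicTime n ht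
  rwa [dyadicTime_apply_one] at this

/-- `dyadicTime n t > 0` for `t > 0` and `n ≥ 1`. -/
theorem dyadicTime_pos {n : ℕ} (hn : 1 ≤ n) {t : ℝ} (ht : 0 < t) : 0 < dyadicTime n t := by
  obtain ⟨m, rfl⟩ := Nat.exists_eq_add_of_le' hn
  rw [dyadicTime_succ]
  split_ifs with h
  · linarith
  · have := dyadicTime_nonneg m (show (0:ℝ) ≤ 2 * t - 1 by linarith)
    linarith

/-- **`dyadicTime n` is injective off its top plateau**: `u < v` in `[0, 1]` with the same dyadic
time have dyadic time `n`. -/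
theorem dyadicTime_eq_of_eq : ∀ (n : ℕ) {u v : ℝ}, 0 ≤ u → u < v → v ≤ 1 →
    dyadicTime n u = dyadicTime n v → dyadicTime n u = n
  | 0, u, v, _, _, _, _ => by simp
  | (n + 1), u, v, hu, huv, hv, h => by
    simp only [dyadicTime_succ] at h ⊢
    by_cases hu2 : u ≤ 1 / 2 <;> by_cases hv2 : v ≤ 1 / 2
    · simp only [if_pos hu2, if_pos hv2] at h
      exact absurd (by linarith : u = v) huv.ne
    · simp only [if_pos hu2, if_neg hv2] at h ⊢
      rcases Nat.eq_zero_or_pos n with rfl | hn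
      · simp only [dyadicTime_zero, add_zero] at h
        simp [h]
      · have hpos := dyadicTime_pos hn (show (0:ℝ) < 2 * v - 1 by linarith)
        exfalso; linarith
    · exfalso; linarith
    · simp only [if_neg hu2, if_neg hv2] at h ⊢
      have ih := dyadicTime_eq_of_eq n (u := 2 * u - 1) (v := 2 * v - 1) (by linarith) (by linarith) (by linarith)
        (by linarith)
      rw [ih]; push_cast; ring

/-- The time change `h u = dyadicTime n (clamp u) / n` is continuous. -/
theorem continuous_timeChange (n : ℕ) :
    Continuous fun x : ℝ => dyadicTime n (max 0 (min 1 x)) / (n : ℝ) :=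
  ((continuous_dyadicTime n).comp (continuous_const.max (continuous_const.min continuous_id))).div_const _

/-- The time change is monotone. -/
theorem monotone_timeChange (n : ℕ) : Monotone fun x : ℝ => dyadicTime n (max 0 (min 1 x)) / (n : ℝ) := by
  intro x y hxy
  exact div_le_div_of_nonneg_right (monotone_dyadicTime n (max_le_max le_rfl (min_le_min le_rfl hxy)))
    (Nat.cast_nonneg n)

/-- The time change vanishes at `0`. -/
theorem timeChange_zero (n : ℕ) : (fun x : ℝ => dyadicTime n (max 0 (min 1 x)) / (n : ℝ)) 0 = 0 := by
  simp

/-- The time change is `1` at `1` (`n ≥ 1`). -/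
theorem timeChange_one {n : ℕ} (hn : 0 < n) : (fun x : ℝ => dyadicTime n (max 0 (min 1 x)) / (n : ℝ)) 1 = 1 := by
  have hn' : (n : ℝ) ≠ 0 := by exact_mod_cast hn.ne'
  simp [hn']

/-- **The time change is injective off its top plateau on `[0, 1]`.** -/
theorem timeChange_plateau {n : ℕ} (hn : 0 < n) (u v : ℝ) (hu : u ∈ Icc (0:ℝ) 1) (hv : v ∈ Icc (0:ℝ) 1)
    (huv : u < v)
    (h : (fun x : ℝ => dyadicTime n (max 0 (min 1 x)) / (n : ℝ)) u =
      (fun x : ℝ => dyadicTime n (max 0 (min 1 x)) / (n : ℝ)) v) :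
    (fun x : ℝ => dyadicTime n (max 0 (min 1 x)) / (n : ℝ)) u = 1 := by
  have hn' : (n : ℝ) ≠ 0 := by exact_mod_cast hn.ne'
  have hcu : max 0 (min 1 u) = u := by rw [min_eq_right hu.2, max_eq_right hu.1]
  have hcv : max 0 (min 1 v) = v := by rw [min_eq_right hv.2, max_eq_right hv.1]
  simp only [hcu, hcv] at h ⊢
  rw [div_left_inj' hn'] at h
  rw [dyadicTime_eq_of_eq n hu.1 huv hv.2 h, div_self hn']

/-! ### The dyadic polyline of a walk -/

section Walk

variable {V : Type*} {G : SimpleGraph V} {u v : V}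

/-- The list of embedded vertices of a walk starts with the embedded start vertex. -/
theorem support_map_eq_cons (w : G.Walk u v) (f : V → ℂ) :
    ∃ l : List ℂ, w.support.map f = f u :: l ∧ l.length = w.length := by
  cases w with
  | nil => exact ⟨[], rfl, rfl⟩
  | cons h p => exact ⟨p.support.map f, rfl, by simp [SimpleGraph.Walk.length_support]⟩

/-- **The polyline of a walk is the dyadic traversal of the affine interpolation** of its embedded
vertices (tree: `polyline_cons_apply`). -/
theorem toCurve_apply (w : G.Walk u v) (f : V → ℂ) (t : unitInterval) :
    w.toCurve f t = affineInterp (w.support.map f) (dyadicTime w.length t) := by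
  obtain ⟨l, hl, hlen⟩ := support_map_eq_cons w f
  unfold SimpleGraph.Walk.toCurve
  rw [hl, polyline_cons_apply, hlen]

/-- The affine interpolation ends at the embedded end vertex: `affineInterp L n = f v`. -/
theorem affineInterp_support_length (f : V → ℂ) : ∀ {u v : V} (w : G.Walk u v),
    affineInterp (w.support.map f) (w.length : ℝ) = f v
  | _, _, SimpleGraph.Walk.nil => by simp
  | _, _, SimpleGraph.Walk.cons h p => by
    obtain ⟨l, hl, hlen⟩ := support_map_eq_cons p f
    rw [SimpleGraph.Walk.support_cons, List.map_cons, hl, SimpleGraph.Walk.length_cons, affineInterp_cons_cons]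
    split_ifs with h1
    · have hp0 : p.length = 0 := by
        have : (p.length : ℝ) + 1 ≤ 1 := by exact_mod_cast h1
        have : (p.length : ℝ) ≤ 0 := by linarith
        exact_mod_cast le_antisymm this (Nat.cast_nonneg _)
      have := SimpleGraph.Walk.eq_of_length_eq_zero hp0
      subst this
      rw [show ((p.length + 1 : ℕ) : ℝ) = 1 by rw [hp0]; norm_num, AffineMap.lineMap_apply_one]
    · have ih := affineInterp_support_length f p
      rw [hl] at ih
      rw [← ih]
      congr 1
      push_cast; ring

end Walk

section Mesh

variable {Ω : Set ℂ} {δ : ℝ} {u v : Site 2}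

/-- **The extended polyline of a walk of positive length is `U ∘ h`.** -/
theorem projLine_toCurve_eq (w : (discreteDomainGraph Ω δ).Walk u v) (hn : 0 < w.length) :
    projLine (w.toCurve (meshPoint δ)) =
      (fun s : ℝ => affineInterp (w.support.map (meshPoint δ)) ((w.length : ℝ) * max 0 (min 1 s))) ∘
        (fun x : ℝ => dyadicTime w.length (max 0 (min 1 x)) / (w.length : ℝ)) := by
  have hn' : (0:ℝ) < w.length := by exact_mod_cast hn
  funext x
  simp only [Function.comp_apply, projLine]
  rw [toCurve_apply, Set.coe_projIcc]
  congr 1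
  have h0 : 0 ≤ dyadicTime w.length (max 0 (min 1 x)) := dyadicTime_nonneg _ (le_max_left _ _)
  have h1 : dyadicTime w.length (max 0 (min 1 x)) ≤ w.length :=
    dyadicTime_le (max_le zero_le_one (min_le_left _ _))
  rw [min_eq_right (div_le_one_of_le₀ h1 hn'.le), max_eq_right (div_nonneg h0 hn'.le), mul_div_cancel₀ _ hn'.ne']

/-- **The extended polyline of the reversed walk is `(U ∘ (1 - ·)) ∘ h`.** -/
theorem projLine_toCurve_reverse_eq (w : (discreteDomainGraph Ω δ).Walk u v) (hn : 0 < w.length) :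
    projLine (w.reverse.toCurve (meshPoint δ)) =
      (fun s : ℝ => affineInterp (w.support.map (meshPoint δ)) ((w.length : ℝ) * max 0 (min 1 (1 - s)))) ∘
        (fun x : ℝ => dyadicTime w.length (max 0 (min 1 x)) / (w.length : ℝ)) := by
  have hn' : (0:ℝ) < w.length := by exact_mod_cast hn
  funext x
  simp only [Function.comp_apply, projLine]
  rw [toCurve_apply, SimpleGraph.Walk.length_reverse, SimpleGraph.Walk.support_reverse, List.map_reverse,
    Set.coe_projIcc]
  obtain ⟨l, hl, hlen⟩ := support_map_eq_cons w (meshPoint δ)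
  have h0 : 0 ≤ dyadicTime w.length (max 0 (min 1 x)) := dyadicTime_nonneg _ (le_max_left _ _)
  have h1 : dyadicTime w.length (max 0 (min 1 x)) ≤ w.length :=
    dyadicTime_le (max_le zero_le_one (min_le_left _ _))
  rw [hl, affineInterp_reverse _ _ ⟨h0, by rw [hlen]; exact h1⟩, hlen]
  congr 1
  have hle : 1 - dyadicTime w.length (max 0 (min 1 x)) / (w.length : ℝ) ≤ 1 := by
    have := div_nonneg h0 hn'.le; linarith
  have hge : 0 ≤ 1 - dyadicTime w.length (max 0 (min 1 x)) / (w.length : ℝ) := by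
    have := div_le_one_of_le₀ h1 hn'.le; linarith
  rw [min_eq_right hle, max_eq_right hge, mul_sub, mul_one, mul_div_cancel₀ _ hn'.ne']

/-- The extended polyline of the trivial walk is constant. -/
theorem projLine_toCurve_nil (u : Site 2) :
    projLine ((SimpleGraph.Walk.nil : (discreteDomainGraph Ω δ).Walk u u).toCurve (meshPoint δ)) =
      fun _ : ℝ => meshPoint δ u := by
  funext x
  simp only [projLine]
  rw [toCurve_apply]
  simp

/-- **Edges of the discrete domain are segments of `closure Ω`, so the interpolation of a walk stays
in `closure Ω`** (given that its starting mesh point does, which only matters for the trivial walk). -/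
theorem affineInterp_support_mem_closure : ∀ {u v : Site 2} (w : (discreteDomainGraph Ω δ).Walk u v),
    meshPoint δ u ∈ closure Ω →
    ∀ x ∈ Icc (0:ℝ) w.length, affineInterp (w.support.map (meshPoint δ)) x ∈ closure Ω
  | _, _, SimpleGraph.Walk.nil, hu, x, _ => by simpa using hu
  | _, _, SimpleGraph.Walk.cons (v := b) h p, _, x, hx => by
    have hseg : segment ℝ (meshPoint δ _) (meshPoint δ b) ⊆ closure Ω :=
      (meshGraph_adj_iff.1 (discreteDomainGraph_adj_iff.1 h).1).2
    have hb : meshPoint δ b ∈ closure Ω := hseg (right_mem_segment _ _ _)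
    obtain ⟨l, hl, hlen⟩ := support_map_eq_cons p (meshPoint δ)
    rw [SimpleGraph.Walk.length_cons] at hx
    rw [SimpleGraph.Walk.support_cons, List.map_cons, hl, affineInterp_cons_cons]
    split_ifs with h1
    · exact hseg (lineMap_mem_segment (𝕜 := ℝ) _ _ ⟨hx.1, h1⟩)
    · have ih := affineInterp_support_mem_closure p hb (x - 1)
        ⟨by linarith [not_le.1 h1], by push_cast at hx; linarith [hx.2]⟩
      rwa [hl] at ih

/-- The start vertex of a walk of positive length lies in the discrete domain, hence its mesh point
lies in `Ω`. -/
theorem meshPoint_start_mem (w : (discreteDomainGraph Ω δ).Walk u v) (hn : 0 < w.length) : meshPoint δ u ∈ Ω := by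
  cases w with
  | nil => simp at hn
  | cons h p => exact meshDomain_subset_meshVertices Ω δ (discreteDomainGraph_adj_iff.1 h).2.1

/-- The end vertex of a walk of positive length lies in the discrete domain. -/
theorem meshPoint_end_mem : ∀ {u v : Site 2} (w : (discreteDomainGraph Ω δ).Walk u v), 0 < w.length →
    meshPoint δ v ∈ Ω
  | _, _, SimpleGraph.Walk.nil, hn => by simp at hn
  | _, _, SimpleGraph.Walk.cons (v := b) h p, _ => by
    rcases Nat.eq_zero_or_pos p.length with h0 | hpos
    · have := SimpleGraph.Walk.eq_of_length_eq_zero h0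
      subst this
      exact meshDomain_subset_meshVertices Ω δ (discreteDomainGraph_adj_iff.1 h).2.2
    · exact meshPoint_end_mem p hpos

/-- A self-avoiding walk of positive length has distinct endpoints. -/
theorem ne_of_isPath_of_length_pos {V : Type*} {G : SimpleGraph V} {u v : V} (w : G.Walk u v) (hw : w.IsPath)
    (hn : 0 < w.length) : u ≠ v := by
  rintro rfl
  rw [SimpleGraph.Walk.isPath_iff_nil, ← SimpleGraph.Walk.length_eq_zero_iff] at hw
  omega

end Mesh

end Summit.CriticalPhenomena.SAWScalingLimit.Theorems.AttachReversal

end
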